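import Summits.AtomisticToContinuum.BoseEinsteinCondensation.Theorems.BECConjugateDominationPositiveMinimiserHeatSmooth
import Summits.AtomisticToContinuum.BoseEinsteinCondensation.Theorems.BECConjugateDominationPositiveMinimiserSmallTime
import Mathlib.MeasureTheory.Integral.IntervalIntegral.FundThmCalculus
import HarnessLib

/-!
# Route `BECConjugateDomination`, support item `PositiveMinimiser` — the regularity bootstrap and
# the Duhamel identity of a periodic Feynman–Kac eigenfunction

Step of item stmt-AtomisticToContinuum-11787.

**Bootstrap.** Each application of the free heat operator `P_t` (`t > 0`) or of the Duhamel term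
`∫₀ᵀ P_s · ds` (`T ≥ 0`) to a periodic `C^k` function gives a `C^{k+1}` function
(`contDiff_heatOp_of_periodic`, `contDiff_duhamel_of_periodic`): induction on `k`, uniformly over the
Banach space of values (the derivative of an `E`-valued function takes values in `(ℝ³)^N →L[ℝ] E`),
base case the Gaussian gradient (`contDiff_one_heatOp`, `contDiff_one_duhamel`), step
`fderiv (P_t f) = P_t (Df)`, `fderiv (duhamel T f) = duhamel T (Df)`. Hence a continuous periodic
`Ψ` with `Ψ = P_T Ψ - duhamel T (w Ψ)` for a periodic `C^k` weight `w` is `C^{k+1}`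
(`contDiff_of_duhamel_identity`).

**Duhamel identity.** For a measurable pair potential with bounded periodisation `v^per ≤ C`, real
interaction `W` (Lipschitz, continuous) and a continuous periodic eigenfunction `Ψ₀` of the periodic
Feynman–Kac semigroup (`e^{-tH}Ψ₀ = e^{-λt}Ψ₀` pointwise): `s ↦ P_sΨ₀(X)` has right derivative
`P_s((W - λ)Ψ₀)(X)` (`hasDerivWithinAt_heatOpR_eigen`, from the uniform generator expansion), so
`∫₀ᵀ P_s((W - λ)Ψ₀)(X) ds = P_TΨ₀(X) - Ψ₀(X)` (`duhamel_eq_of_eigen`, FTC for right derivatives), and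
**if `W` is periodic and `C^k` then `Ψ₀ ∈ C^{k+1}`** (`contDiff_of_eigen`; `W ∈ C²` gives `C³`).
[folklore]
-/

noncomputable section

namespace Summit.AtomisticToContinuum.BoseEinsteinCondensation.Theorems.PositiveMinimiser

open MeasureTheory ProbabilityTheory Filter Set Metric intervalIntegral
open scoped ENNReal NNReal Topology
open Literature.MathematicalPhysics.QuantumManyBody.BoseGas

section Bootstrap

variable {N : ℕ}

/-- **`P_t` maps periodic `C^k` functions to `C^{k+1}` functions** (`t > 0`; any complete space of
values; induction on `k` through the spaces of derivatives). [folklore] -/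
theorem contDiff_heatOp_of_periodic {L : ℝ} (hL : 0 < L) {t : ℝ≥0} (ht : t ≠ 0) (k : ℕ) :
    ∀ {E : Type} [NormedAddCommGroup E] [NormedSpace ℝ E] [CompleteSpace E] {f : Config N → E},
      ContDiff ℝ k f →
      (∀ (X : Config N) (i : Fin N) (c : Fin 3),
        f (X + Pi.single i (EuclideanSpace.single c L)) = f X) →
      ContDiff ℝ (k + 1) (heatOp t f) := by
  induction k with
  | zero =>
    intro E _ _ _ f hf hper
    have hfc : Continuous f := hf.continuous
    obtain ⟨M, -, hM⟩ := exists_bound_of_continuous_periodicE hL hfc hper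
    simpa using contDiff_one_heatOp hfc hM ht
  | succ k ih =>
    intro E _ _ _ f hf hper
    have hf1 : ContDiff ℝ 1 f := hf.of_le (by exact_mod_cast Nat.le_add_left 1 k)
    have hfc : Continuous f := hf1.continuous
    have hdf : ContDiff ℝ k (fderiv ℝ f) := hf.fderiv_right (by push_cast; exact le_rfl)
    have hdper : ∀ (X : Config N) (i : Fin N) (c : Fin 3),
        fderiv ℝ f (X + Pi.single i (EuclideanSpace.single c L)) = fderiv ℝ f X :=
      fderiv_periodicE hper
    obtain ⟨M, -, hM⟩ := exists_bound_of_continuous_periodicE hL hfc hper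
    obtain ⟨M', -, hM'⟩ :=
      exists_bound_of_continuous_periodicE hL (hf1.continuous_fderiv one_ne_zero) hdper
    have hih : ContDiff ℝ (k + 1) (heatOp t (fderiv ℝ f)) := ih hdf hdper
    have hderiv : fderiv ℝ (heatOp t f) = heatOp t (fderiv ℝ f) := fderiv_heatOp_of_contDiff hf1 hM hM' t
    refine contDiff_succ_iff_fderiv.2 ⟨fun X => (hasFDerivAt_heatOp_of_contDiff hf1 hM hM' t X).differentiableAt,
      fun h => absurd h (WithTop.natCast_ne_top _), ?_⟩
    rw [hderiv]
    exact_mod_cast hih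

/-- **The Duhamel term maps periodic `C^k` functions to `C^{k+1}` functions** (`T ≥ 0`).
[folklore] -/
theorem contDiff_duhamel_of_periodic {L : ℝ} (hL : 0 < L) {T : ℝ} (hT : 0 ≤ T) (k : ℕ) :
    ∀ {E : Type} [NormedAddCommGroup E] [NormedSpace ℝ E] [CompleteSpace E] {f : Config N → E},
      ContDiff ℝ k f →
      (∀ (X : Config N) (i : Fin N) (c : Fin 3),
        f (X + Pi.single i (EuclideanSpace.single c L)) = f X) →
      ContDiff ℝ (k + 1) (duhamel T f) := by
  induction k with
  | zero =>
    intro E _ _ _ f hf hper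
    have hfc : Continuous f := hf.continuous
    obtain ⟨M, -, hM⟩ := exists_bound_of_continuous_periodicE hL hfc hper
    simpa using contDiff_one_duhamel hfc hM hT
  | succ k ih =>
    intro E _ _ _ f hf hper
    have hf1 : ContDiff ℝ 1 f := hf.of_le (by exact_mod_cast Nat.le_add_left 1 k)
    have hfc : Continuous f := hf1.continuous
    have hdf : ContDiff ℝ k (fderiv ℝ f) := hf.fderiv_right (by push_cast; exact le_rfl)
    have hdper : ∀ (X : Config N) (i : Fin N) (c : Fin 3),
        fderiv ℝ f (X + Pi.single i (EuclideanSpace.single c L)) = fderiv ℝ f X :=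
      fderiv_periodicE hper
    obtain ⟨M, -, hM⟩ := exists_bound_of_continuous_periodicE hL hfc hper
    obtain ⟨M', -, hM'⟩ :=
      exists_bound_of_continuous_periodicE hL (hf1.continuous_fderiv one_ne_zero) hdper
    have hih : ContDiff ℝ (k + 1) (duhamel T (fderiv ℝ f)) := ih hdf hdper
    have hderiv : fderiv ℝ (duhamel T f) = duhamel T (fderiv ℝ f) :=
      fderiv_duhamel_of_contDiff hf1 hM hM' T
    refine contDiff_succ_iff_fderiv.2 ⟨fun X => (hasFDerivAt_duhamel_of_contDiff hf1 hM hM' T X).differentiableAt,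
      fun h => absurd h (WithTop.natCast_ne_top _), ?_⟩
    rw [hderiv]
    exact_mod_cast hih

/-- **One step of the bootstrap**: if a periodic `Ψ` satisfies the Duhamel identity
`Ψ X = P_T Ψ X - duhamel T (fun Y => w Y • Ψ Y) X` (`T > 0`) with a periodic real weight `w`, and
both `Ψ` and `w` are `C^k`, then `Ψ` is `C^{k+1}`. [folklore] -/
theorem contDiff_succ_of_duhamel_identity {L : ℝ} (hL : 0 < L) {T : ℝ≥0} (hT : T ≠ 0) {k : ℕ}
    {Ψ w : Config N → ℝ} (hΨ : ContDiff ℝ k Ψ) (hw : ContDiff ℝ k w)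
    (hΨper : ∀ (X : Config N) (i : Fin N) (c : Fin 3),
      Ψ (X + Pi.single i (EuclideanSpace.single c L)) = Ψ X)
    (hwper : ∀ (X : Config N) (i : Fin N) (c : Fin 3),
      w (X + Pi.single i (EuclideanSpace.single c L)) = w X)
    (hid : ∀ X, Ψ X = heatOp T Ψ X - duhamel T (fun Y => w Y * Ψ Y) X) :
    ContDiff ℝ (k + 1) Ψ := by
  have hprod : ContDiff ℝ k (fun Y => w Y * Ψ Y) := hw.mul hΨ
  have hprodper : ∀ (X : Config N) (i : Fin N) (c : Fin 3),
      (fun Y => w Y * Ψ Y) (X + Pi.single i (EuclideanSpace.single c L)) = (fun Y => w Y * Ψ Y) X := by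
    intro X i c; simp only [hwper, hΨper]
  have h1 : ContDiff ℝ (k + 1) (heatOp T Ψ) := contDiff_heatOp_of_periodic hL hT k hΨ hΨper
  have h2 : ContDiff ℝ (k + 1) (duhamel (T : ℝ) (fun Y => w Y * Ψ Y)) :=
    contDiff_duhamel_of_periodic hL T.coe_nonneg k hprod hprodper
  have heq : Ψ = fun X => heatOp T Ψ X - duhamel T (fun Y => w Y * Ψ Y) X := funext hid
  rw [heq]
  exact h1.sub h2

/-- **The bootstrap**: a continuous periodic `Ψ` satisfying the Duhamel identity with a periodic
`C^k` real weight `w` is `C^{k+1}` (iterate `contDiff_succ_of_duhamel_identity` from `C⁰`).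
[folklore] -/
theorem contDiff_of_duhamel_identity {L : ℝ} (hL : 0 < L) {T : ℝ≥0} (hT : T ≠ 0) (k : ℕ)
    {Ψ w : Config N → ℝ} (hΨ : Continuous Ψ) (hw : ContDiff ℝ k w)
    (hΨper : ∀ (X : Config N) (i : Fin N) (c : Fin 3),
      Ψ (X + Pi.single i (EuclideanSpace.single c L)) = Ψ X)
    (hwper : ∀ (X : Config N) (i : Fin N) (c : Fin 3),
      w (X + Pi.single i (EuclideanSpace.single c L)) = w X)
    (hid : ∀ X, Ψ X = heatOp T Ψ X - duhamel T (fun Y => w Y * Ψ Y) X) :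
    ContDiff ℝ (k + 1) Ψ := by
  induction k with
  | zero =>
    exact contDiff_succ_of_duhamel_identity hL hT (contDiff_zero.2 hΨ) hw hΨper hwper hid
  | succ k ih =>
    have hk : ContDiff ℝ (k + 1) Ψ := ih (hw.of_le (by exact_mod_cast Nat.le_succ k))
    have := contDiff_succ_of_duhamel_identity hL hT (k := k + 1) (by exact_mod_cast hk) hw hΨper hwper hid
    exact_mod_cast this

end Bootstrap

/-! ### The Duhamel identity -/

variable {N : ℕ} {v : ℝ → ℝ≥0∞} {L : ℝ} {C : ℝ≥0}

/-- **Increment of the free flow of an eigenfunction against the Duhamel integrand**: with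
`w = (W - λ)Ψ₀`, for `s, h ≥ 0` with `h ≤ t₀(ε)`,
`|P_{s+h}Ψ₀(X) - P_sΨ₀(X) - h P_s w(X)| ≤ ε h` (semigroup law, then the uniform expansion under
`P_s`). [folklore] -/
theorem abs_heatOp_add_sub_le (hv : Measurable v) (hL : 0 < L)
    (hC : ∀ x, periodizedPotential v L x ≤ C) {G : ℝ} (hG : 0 ≤ G)
    (hlip : ∀ Y Z : Config N, |(periodicInteraction v L Y).toReal - (periodicInteraction v L Z).toReal|
      ≤ G * ‖Y - Z‖)
    (hWcont : Continuous fun X : Config N => (periodicInteraction v L X).toReal)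
    {Ψ₀ : Config N → ℝ} (hcont : Continuous Ψ₀)
    (hper : ∀ (X : Config N) (i : Fin N) (k : Fin 3),
      Ψ₀ (X + Pi.single i (EuclideanSpace.single k L)) = Ψ₀ X)
    {lam : ℝ} (heig : ∀ t : ℝ, 0 < t → ∀ X, pfkReal v L t Ψ₀ X = Real.exp (-(lam * t)) * Ψ₀ X)
    {ε : ℝ} (hε : 0 < ε) :
    ∃ t₀ : ℝ, 0 < t₀ ∧ ∀ (s h : ℝ≥0), (h : ℝ) ≤ t₀ → ∀ X : Config N,
      |heatOp (s + h) Ψ₀ X - heatOp s Ψ₀ X -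
        h * heatOp s (fun Y => ((periodicInteraction v L Y).toReal - lam) * Ψ₀ Y) X| ≤ ε * h := by
  obtain ⟨t₀, ht₀, hexp⟩ := heatOp_expansion_of_eigen hv hL hC hG hlip hcont hper heig hε
  obtain ⟨M, hM0, hM⟩ := exists_bound_of_continuous_periodic hL hcont hper
  set w : Config N → ℝ := fun Y => ((periodicInteraction v L Y).toReal - lam) * Ψ₀ Y with hw
  have hwcont : Continuous w := (hWcont.sub continuous_const).mul hcont
  -- a bound for `w`
  have hWb : ∀ Y : Config N, |(periodicInteraction v L Y).toReal - lam| ≤ ((N * N : ℕ) : ℝ) * C + |lam| := by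
    intro Y
    refine (abs_sub _ _).trans (add_le_add ?_ le_rfl)
    rw [abs_of_nonneg ENNReal.toReal_nonneg]
    exact toReal_periodicInteraction_le hC Y
  have hwb : ∀ Y, ‖w Y‖ ≤ (((N * N : ℕ) : ℝ) * C + |lam|) * M := fun Y => by
    rw [Real.norm_eq_abs, hw]; simp only; rw [abs_mul]
    exact mul_le_mul (hWb Y) (hM Y) (abs_nonneg _) (by positivity)
  refine ⟨t₀, ht₀, fun s h hh X => ?_⟩
  have hh0 : (0 : ℝ) ≤ h := h.coe_nonneg
  -- semigroup law and linearity: the increment is `P_s` of the small-time remainder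
  have hPh : Continuous (heatOp h Ψ₀) :=
    continuous_heatOp (E := ℝ) hcont (fun Y => by rw [Real.norm_eq_abs]; exact hM Y) h
  have hPhb : ∀ Y, ‖heatOp h Ψ₀ Y‖ ≤ M := fun Y =>
    norm_heatOp_le (fun Z => by rw [Real.norm_eq_abs]; exact hM Z) h Y
  have hi1 : Integrable (fun ω => heatOp h Ψ₀ (X + displacement s ω)) (wienerPaths N) :=
    integrable_comp_add_displacement hPh hPhb X s
  have hi2 : Integrable (fun ω => Ψ₀ (X + displacement s ω)) (wienerPaths N) :=
    integrable_comp_add_displacement (E := ℝ) hcont (fun Y => by rw [Real.norm_eq_abs]; exact hM Y) X s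
  have hi3 : Integrable (fun ω => (h : ℝ) * w (X + displacement s ω)) (wienerPaths N) :=
    (integrable_comp_add_displacement hwcont hwb X s).const_mul (h : ℝ)
  have hi12 : Integrable (fun ω => heatOp h Ψ₀ (X + displacement s ω) - Ψ₀ (X + displacement s ω))
      (wienerPaths N) := hi1.sub hi2
  have hI : heatOp (s + h) Ψ₀ X - heatOp s Ψ₀ X - h * heatOp s w X =
      ∫ ω, (heatOp h Ψ₀ (X + displacement s ω) - Ψ₀ (X + displacement s ω) -
        h * w (X + displacement s ω)) ∂wienerPaths N := by
    rw [heatOp_add_time hL hcont hper s h X, integral_sub hi12 hi3, integral_sub hi1 hi2,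
      MeasureTheory.integral_const_mul]
    rfl
  rw [hI, ← Real.norm_eq_abs]
  have hbd : ∀ ω, ‖heatOp h Ψ₀ (X + displacement s ω) - Ψ₀ (X + displacement s ω) -
      h * w (X + displacement s ω)‖ ≤ ε * h := fun ω => by
    rw [Real.norm_eq_abs]; exact hexp h hh _
  refine (norm_integral_le_of_norm_le (integrable_const _) (Eventually.of_forall hbd)).trans ?_
  simp

/-- **Right derivative of the free flow of an eigenfunction**: for every real `s ≥ 0`,
`d⁺/ds P_sΨ₀(X) = P_s((W - λ)Ψ₀)(X)`. [folklore] -/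
theorem hasDerivWithinAt_heatOpR_eigen (hv : Measurable v) (hL : 0 < L)
    (hC : ∀ x, periodizedPotential v L x ≤ C) {G : ℝ} (hG : 0 ≤ G)
    (hlip : ∀ Y Z : Config N, |(periodicInteraction v L Y).toReal - (periodicInteraction v L Z).toReal|
      ≤ G * ‖Y - Z‖)
    (hWcont : Continuous fun X : Config N => (periodicInteraction v L X).toReal)
    {Ψ₀ : Config N → ℝ} (hcont : Continuous Ψ₀)
    (hper : ∀ (X : Config N) (i : Fin N) (k : Fin 3),
      Ψ₀ (X + Pi.single i (EuclideanSpace.single k L)) = Ψ₀ X)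
    {lam : ℝ} (heig : ∀ t : ℝ, 0 < t → ∀ X, pfkReal v L t Ψ₀ X = Real.exp (-(lam * t)) * Ψ₀ X)
    {s : ℝ} (hs : 0 ≤ s) (X : Config N) :
    HasDerivWithinAt (fun r : ℝ => heatOpR r Ψ₀ X)
      (heatOpR s (fun Y => ((periodicInteraction v L Y).toReal - lam) * Ψ₀ Y) X) (Ioi s) s := by
  set w : Config N → ℝ := fun Y => ((periodicInteraction v L Y).toReal - lam) * Ψ₀ Y with hw
  rw [hasDerivWithinAt_iff_tendsto, Metric.tendsto_nhdsWithin_nhds]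
  intro ε hε
  obtain ⟨t₀, ht₀, hincr⟩ := abs_heatOp_add_sub_le hv hL hC hG hlip hWcont hcont hper heig (half_pos hε)
  refine ⟨t₀, ht₀, fun r hr hdist => ?_⟩
  have hrs : s < r := hr
  have hrs0 : 0 < r - s := sub_pos.2 hrs
  have hr0 : 0 ≤ r := hs.trans hrs.le
  have hdist' : r - s ≤ t₀ := by
    rw [Real.dist_eq, abs_of_pos hrs0] at hdist; exact hdist.le
  -- `P_r = P_{s + (r - s)}` on `ℝ≥0`
  have hsplit : r.toNNReal = s.toNNReal + (r - s).toNNReal := by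
    rw [← Real.toNNReal_add hs hrs0.le]; congr 1; ring
  have hkey := hincr s.toNNReal (r - s).toNNReal (by rw [Real.coe_toNNReal _ hrs0.le]; exact hdist') X
  rw [← hsplit, Real.coe_toNNReal _ hrs0.le] at hkey
  rw [Real.dist_eq, sub_zero]
  simp only [heatOpR]
  rw [abs_mul, abs_inv, abs_norm, Real.norm_eq_abs, abs_of_pos hrs0, smul_eq_mul, Real.norm_eq_abs, abs_abs]
  calc (r - s)⁻¹ * |heatOp r.toNNReal Ψ₀ X - heatOp s.toNNReal Ψ₀ X - (r - s) * heatOp s.toNNReal w X|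
      ≤ (r - s)⁻¹ * (ε / 2 * (r - s)) := mul_le_mul_of_nonneg_left hkey (inv_nonneg.2 hrs0.le)
    _ = ε / 2 := by field_simp
    _ < ε := half_lt_self hε

/-- **The Duhamel identity of a periodic Feynman–Kac eigenfunction**: for `T ≥ 0` and every `X`,
`duhamel T ((W - λ)Ψ₀) X = ∫₀ᵀ P_s((W - λ)Ψ₀)(X) ds = P_TΨ₀(X) - Ψ₀(X)`. [folklore] -/
theorem duhamel_eq_of_eigen (hv : Measurable v) (hL : 0 < L)
    (hC : ∀ x, periodizedPotential v L x ≤ C) {G : ℝ} (hG : 0 ≤ G)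
    (hlip : ∀ Y Z : Config N, |(periodicInteraction v L Y).toReal - (periodicInteraction v L Z).toReal|
      ≤ G * ‖Y - Z‖)
    (hWcont : Continuous fun X : Config N => (periodicInteraction v L X).toReal)
    {Ψ₀ : Config N → ℝ} (hcont : Continuous Ψ₀)
    (hper : ∀ (X : Config N) (i : Fin N) (k : Fin 3),
      Ψ₀ (X + Pi.single i (EuclideanSpace.single k L)) = Ψ₀ X)
    {lam : ℝ} (heig : ∀ t : ℝ, 0 < t → ∀ X, pfkReal v L t Ψ₀ X = Real.exp (-(lam * t)) * Ψ₀ X)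
    (T : ℝ≥0) (X : Config N) :
    duhamel T (fun Y => ((periodicInteraction v L Y).toReal - lam) * Ψ₀ Y) X = heatOp T Ψ₀ X - Ψ₀ X := by
  obtain ⟨M, hM0, hM⟩ := exists_bound_of_continuous_periodic hL hcont hper
  set w : Config N → ℝ := fun Y => ((periodicInteraction v L Y).toReal - lam) * Ψ₀ Y with hw
  have hwcont : Continuous w := (hWcont.sub continuous_const).mul hcont
  have hWb : ∀ Y : Config N, |(periodicInteraction v L Y).toReal - lam| ≤ ((N * N : ℕ) : ℝ) * C + |lam| := by
    intro Y
    refine (abs_sub _ _).trans (add_le_add ?_ le_rfl)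
    rw [abs_of_nonneg ENNReal.toReal_nonneg]
    exact toReal_periodicInteraction_le hC Y
  have hwb : ∀ Y, ‖w Y‖ ≤ (((N * N : ℕ) : ℝ) * C + |lam|) * M := fun Y => by
    rw [Real.norm_eq_abs, hw]; simp only; rw [abs_mul]
    exact mul_le_mul (hWb Y) (hM Y) (abs_nonneg _) (by positivity)
  have hMn : ∀ Y, ‖Ψ₀ Y‖ ≤ M := fun Y => by rw [Real.norm_eq_abs]; exact hM Y
  have hφ : Continuous fun r : ℝ => heatOpR r Ψ₀ X := continuous_heatOpR (E := ℝ) hcont hMn X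
  have hφ' : Continuous fun r : ℝ => heatOpR r w X := continuous_heatOpR hwcont hwb X
  have hderiv : ∀ r ∈ Ioo (0 : ℝ) T, HasDerivWithinAt (fun r : ℝ => heatOpR r Ψ₀ X)
      (heatOpR r w X) (Ioi r) r := fun r hr =>
    hasDerivWithinAt_heatOpR_eigen hv hL hC hG hlip hWcont hcont hper heig hr.1.le X
  have hftc := integral_eq_sub_of_hasDeriv_right_of_le T.coe_nonneg hφ.continuousOn hderiv
    (hφ'.intervalIntegrable _ _)
  rw [duhamel, hftc, heatOpR_coe, heatOpR_of_nonpos le_rfl]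

/-- **Regularity of a periodic Feynman–Kac eigenfunction**: if the real interaction `W` is
periodic, Lipschitz and `C^k`, then a continuous periodic eigenfunction `Ψ₀` (`e^{-tH}Ψ₀ = e^{-λt}Ψ₀`
pointwise) is `C^{k+1}` — the Duhamel identity at `T = 1` and the bootstrap. With `W ∈ C²`
(smooth-class pair potentials) the Feynman–Kac ground state is `C³`. [folklore] -/
theorem contDiff_of_eigen (hv : Measurable v) (hL : 0 < L)
    (hC : ∀ x, periodizedPotential v L x ≤ C) {G : ℝ} (hG : 0 ≤ G)
    (hlip : ∀ Y Z : Config N, |(periodicInteraction v L Y).toReal - (periodicInteraction v L Z).toReal|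
      ≤ G * ‖Y - Z‖)
    {k : ℕ} (hWk : ContDiff ℝ k fun X : Config N => (periodicInteraction v L X).toReal)
    (hWper : ∀ (X : Config N) (i : Fin N) (c : Fin 3),
      (periodicInteraction v L (X + Pi.single i (EuclideanSpace.single c L))).toReal =
        (periodicInteraction v L X).toReal)
    {Ψ₀ : Config N → ℝ} (hcont : Continuous Ψ₀)
    (hper : ∀ (X : Config N) (i : Fin N) (k : Fin 3),
      Ψ₀ (X + Pi.single i (EuclideanSpace.single k L)) = Ψ₀ X)
    {lam : ℝ} (heig : ∀ t : ℝ, 0 < t → ∀ X, pfkReal v L t Ψ₀ X = Real.exp (-(lam * t)) * Ψ₀ X) :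
    ContDiff ℝ (k + 1) Ψ₀ := by
  have hWcont : Continuous fun X : Config N => (periodicInteraction v L X).toReal := hWk.continuous
  have hid : ∀ X, Ψ₀ X = heatOp (1 : ℝ≥0) Ψ₀ X -
      duhamel ((1 : ℝ≥0) : ℝ) (fun Y => ((periodicInteraction v L Y).toReal - lam) * Ψ₀ Y) X := by
    intro X
    rw [duhamel_eq_of_eigen hv hL hC hG hlip hWcont hcont hper heig 1 X]
    ring
  exact contDiff_of_duhamel_identity hL one_ne_zero k hcont (hWk.sub contDiff_const) hper
    (fun X i c => by simp only [hWper]) hid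

end Summit.AtomisticToContinuum.BoseEinsteinCondensation.Theorems.PositiveMinimiser

end
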